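import Literature.ModelTheory.PseudofiniteFields.EtaleOpenTopologyBasis
import HarnessLib

/-!
# Generic points of decomposed sets are étale-interior; translates through interior points

Topic `Literature/ModelTheory/PseudofiniteFields`.  Elementary consequences of the rendering of
the étale-open topology on `K^m` in `EtaleOpenTopology.lean` (`EtaleDatum.image`, `IsEtaleOpenIn`,
`IsEtaleIsolatedIn`, `SmoothDatum.locus`) and of its basis calculus
(`EtaleOpenTopologyBasis.lean`: principal opens, translates, intersections), for sets
`U = ⋃_i X_i ⊆ K^m` DECOMPOSED à la Walsberg–Ye [WalsbergYe2023, Thm C (1)]: finitely many pieces,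
each a point or an étale-open subset of a standard smooth locus of codimension `c_i < m`.

* `exists_ne_zero_forall_etaleNhd_of_piece`, `exists_ne_zero_forall_etaleNhd_of_iUnion` — there
  is a NON-ZERO polynomial `D` such that every point `P` of `U` with `D(P) ≠ 0` is an
  étale-interior point of `U` in `K^m` ("generic points are interior"): `D` is the product over
  the pieces of a linear form through the point (point pieces), of the first equation `g_0` of the
  locus (pieces of positive codimension; `g_0 ≠ 0` because the Jacobian minor is non-zero on a
  nonempty piece) and of `1` (codimension-`0` pieces, which are étale-open in `K^m` itself).
* `exists_open_piece_of_infinite` — an infinite decomposed set has a nonempty piece that is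
  étale-open in a positive-dimensional locus.
* `exists_ne_mem_of_not_isEtaleIsolatedIn` — at a NON-ISOLATED point `a₀` of a locus `V`, every
  étale neighbourhood of `a₀` meets an étale-open `Y ∋ a₀` of `V` in a second point.
* `exists_translate_mem_of_etaleNhd`, `exists_ne_zero_forall_translate_mem` — **no lonely
  translate through an interior point**: if no point of a positive-dimensional standard smooth
  locus is étale-isolated (the conclusion of [JohnsonTranWalsbergYe2024, Thm 7.1] over large, e.g.
  pseudo-finite, fields — entering as the hypothesis `hiso`), `t` is étale-interior in `T`, and
  `A` is infinite and decomposed, then `t + a − a₀ ∈ T` for some `a ≠ a₀` in `A`.  Combined with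
  the first item: off the hypersurface `D = 0` every point of a decomposed `T` has this property.

These are the topological steps of the "no lonely generic point" theorem for definable sets over
finite fields (`NoLonelyTranslates.lean`); the named facts of `EtaleOpenTopology.lean` are NOT used
here (their conclusions enter as hypotheses), so everything in this file is unconditional.

## References

* [JohnsonTranWalsbergYe2024] W. Johnson, C.-M. Tran, E. Walsberg, J. Ye, The étale-open topology
  and the stable fields conjecture, J. Eur. Math. Soc. 26 (2024), Thm 7.1, Thm A.
* [WalsbergYe2023] E. Walsberg, J. Ye, Éz fields, J. Algebra 614 (2023), Thm C (1), Thm D.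
-/

namespace Literature.ModelTheory.PseudofiniteFields

open MvPolynomial

variable {K : Type*} [Field K] {m : ℕ}

/-- **Per-piece polynomial.**  For one piece `X` of a Walsberg–Ye decomposition in `K^m`, `0 < m`
(a point, or an étale-open subset of a standard smooth locus of codimension `c < m`), there is a
NON-ZERO polynomial `D` such that every `P ∈ X` with `D(P) ≠ 0` has a basic étale neighbourhood
inside `X`: `D` is a linear form through the point if `X` is a point, the first equation `g_0` of
the locus if `0 < c` (non-zero since the Jacobian minor does not vanish on `X ≠ ∅`), and `1` if
`c = 0`, when the locus `{h ≠ 0, Δ ≠ 0}` is a principal open, hence a basic étale-open set, so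
that `X` is étale-open in `K^m`. [folklore] -/
theorem exists_ne_zero_forall_etaleNhd_of_piece (hm : 0 < m) {c : ℕ} (S : SmoothDatum K m c)
    (X : Set (Fin m → K)) (hX : X.Subsingleton ∨ (c < m ∧ IsEtaleOpenIn K S.locus X)) :
    ∃ D : MvPolynomial (Fin m) K, D ≠ 0 ∧ ∀ P ∈ X, eval P D ≠ 0 →
      ∃ (r : ℕ) (O : EtaleDatum K m r), P ∈ O.image ∧ O.image ⊆ X := by
  classical
  by_cases hsub : X.Subsingleton
  · rcases hsub.eq_empty_or_singleton with rfl | ⟨p, rfl⟩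
    · exact ⟨1, one_ne_zero, fun P hP => hP.elim⟩
    · refine ⟨MvPolynomial.X ⟨0, hm⟩ - C (p ⟨0, hm⟩), fun h => ?_, fun P hP hPD => ?_⟩
      · have h1 := congr_arg (eval fun _ => p ⟨0, hm⟩ + 1) h
        simp at h1
      · rw [Set.mem_singleton_iff] at hP
        subst hP
        simp at hPD
  · obtain ⟨-, hXloc, hnb⟩ := hX.resolve_left hsub
    rcases Nat.eq_zero_or_pos c with hc | hc
    · subst hc
      refine ⟨1, one_ne_zero, fun P hP _ => ?_⟩
      obtain ⟨r, E, hPE, hEX⟩ := hnb P hP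
      obtain ⟨E₀, hE₀⟩ := EtaleDatum.exists_image_eq_setOf_eval_ne_zero (S.h * S.minor)
      obtain ⟨O, hO⟩ := E.exists_image_eq_inter E₀
      have hloc : S.locus = E₀.image := by
        rw [hE₀]
        ext z
        simp [SmoothDatum.mem_locus_iff]
      refine ⟨r + 1, O, ?_, ?_⟩
      · rw [hO]
        exact ⟨hPE, hloc ▸ hXloc hP⟩
      · rw [hO, ← hloc]
        exact hEX
    · refine ⟨S.g ⟨0, hc⟩, fun hg => ?_, fun P hP hPD => absurd ((hXloc hP).1 ⟨0, hc⟩) hPD⟩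
      obtain ⟨p, hp⟩ := (Set.not_subsingleton_iff.1 hsub).nonempty
      have hmin : S.minor = 0 := by
        unfold SmoothDatum.minor
        exact Matrix.det_eq_zero_of_row_eq_zero ⟨0, hc⟩ fun j => by simp [hg]
      exact (hXloc hp).2.2 (by rw [hmin, map_zero])

/-- **Generic points of a decomposed set are étale-interior.**  If `U = ⋃_i X_i ⊆ K^m` (`0 < m`,
finitely many pieces, each a point or étale-open in a standard smooth locus of codimension `< m`),
then for some NON-ZERO polynomial `D` (the product of the per-piece polynomials) every `P ∈ U`
with `D(P) ≠ 0` has a basic étale neighbourhood contained in `U`. [folklore] -/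
theorem exists_ne_zero_forall_etaleNhd_of_iUnion (hm : 0 < m) {k : ℕ} {c : Fin k → ℕ}
    (S : ∀ i, SmoothDatum K m (c i)) (X : Fin k → Set (Fin m → K))
    (hX : ∀ i, (X i).Subsingleton ∨ (c i < m ∧ IsEtaleOpenIn K (S i).locus (X i))) :
    ∃ D : MvPolynomial (Fin m) K, D ≠ 0 ∧ ∀ P ∈ ⋃ i, X i, eval P D ≠ 0 →
      ∃ (r : ℕ) (O : EtaleDatum K m r), P ∈ O.image ∧ O.image ⊆ ⋃ i, X i := by
  classical
  choose Dp hDp0 hDp using fun i => exists_ne_zero_forall_etaleNhd_of_piece hm (S i) (X i) (hX i)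
  refine ⟨∏ i, Dp i, Finset.prod_ne_zero_iff.2 fun i _ => hDp0 i, fun P hP hPD => ?_⟩
  obtain ⟨i, hPi⟩ := Set.mem_iUnion.1 hP
  rw [map_prod] at hPD
  obtain ⟨r, O, hPO, hOX⟩ := hDp i P hPi (Finset.prod_ne_zero_iff.1 hPD i (Finset.mem_univ i))
  exact ⟨r, O, hPO, hOX.trans (Set.subset_iUnion X i)⟩

/-- An infinite set decomposed into finitely many pieces, each a point or an étale-open subset of
a standard smooth locus of codimension `< m`, has an infinite — hence nonempty, non-point — piece,
which is therefore étale-open in a positive-dimensional locus. [folklore] -/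
theorem exists_open_piece_of_infinite {k : ℕ} {c : Fin k → ℕ} (S : ∀ i, SmoothDatum K m (c i))
    (X : Fin k → Set (Fin m → K))
    (hX : ∀ i, (X i).Subsingleton ∨ (c i < m ∧ IsEtaleOpenIn K (S i).locus (X i)))
    (hinf : (⋃ i, X i).Infinite) :
    ∃ i, c i < m ∧ IsEtaleOpenIn K (S i).locus (X i) ∧ (X i).Infinite := by
  obtain ⟨i, hi⟩ : ∃ i, (X i).Infinite := by
    by_contra h
    exact hinf (Set.finite_iUnion fun i => Set.not_infinite.1 (not_exists.1 h i))
  obtain ⟨hci, hopen⟩ := (hX i).resolve_left fun hs => hi hs.finite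
  exact ⟨i, hci, hopen, hi⟩

/-- **A non-isolated point is approached inside every neighbourhood.**  If `Y` is étale-open in
the locus `V`, `a₀ ∈ Y` is NOT étale-isolated in `V`, and `O` is a basic étale neighbourhood of
`a₀`, then `O` contains a point `a ≠ a₀` of `Y` (intersect `O` with a neighbourhood of `a₀` whose
trace on `V` lies in `Y`; non-isolation gives a second point of `V` in it). [folklore] -/
theorem exists_ne_mem_of_not_isEtaleIsolatedIn {c : ℕ} (S : SmoothDatum K m c)
    {Y : Set (Fin m → K)} (hY : IsEtaleOpenIn K S.locus Y) {a₀ : Fin m → K} (ha₀ : a₀ ∈ Y)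
    (hiso : ¬ IsEtaleIsolatedIn K S.locus a₀) {r : ℕ} (O : EtaleDatum K m r)
    (hO : a₀ ∈ O.image) : ∃ a ∈ Y, a ≠ a₀ ∧ a ∈ O.image := by
  obtain ⟨hYloc, hnb⟩ := hY
  obtain ⟨r₁, E₁, ha₀E, hEY⟩ := hnb a₀ ha₀
  obtain ⟨N, hN⟩ := O.exists_image_eq_inter E₁
  have ha₀N : a₀ ∈ N.image := by
    rw [hN]
    exact ⟨hO, ha₀E⟩
  have hnot : ¬ (N.image ∩ S.locus ⊆ {a₀}) := fun hsub =>
    hiso ⟨hYloc ha₀, r + r₁, N, ha₀N, hsub⟩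
  obtain ⟨a, ⟨haN, haloc⟩, hane⟩ := Set.not_subset.1 hnot
  rw [hN] at haN
  exact ⟨a, hEY ⟨haN.2, haloc⟩, fun h => hane (Set.mem_singleton_iff.2 h), haN.1⟩

/-- **No lonely translate through an interior point.**  Suppose no point of a standard smooth
locus of codimension `< m` in `K^m` is étale-isolated (`hiso`; the conclusion of
Johnson–Tran–Walsberg–Ye 2024, Thm 7.1, over a large field).  If `t` has a basic étale
neighbourhood `O ⊆ T`, and `A = ⋃_i X_i` is INFINITE and decomposed (points and étale-open pieces
of loci of codimension `< m`), then `t + a − a₀ ∈ T` for some `a ≠ a₀` in `A`: pick `a₀` in an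
infinite open piece `Y` of `A`, translate `O` to `a₀`, and take a second point `a ∈ Y` of that
neighbourhood. [folklore] -/
theorem exists_translate_mem_of_etaleNhd
    (hiso : ∀ c : ℕ, c < m → ∀ (S : SmoothDatum K m c) (p : Fin m → K),
      ¬ IsEtaleIsolatedIn K S.locus p)
    {T A : Set (Fin m → K)} {t : Fin m → K} {r : ℕ} (O : EtaleDatum K m r) (htO : t ∈ O.image)
    (hOT : O.image ⊆ T) {k : ℕ} {c : Fin k → ℕ} (S : ∀ i, SmoothDatum K m (c i))
    (X : Fin k → Set (Fin m → K)) (hAX : A = ⋃ i, X i)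
    (hX : ∀ i, (X i).Subsingleton ∨ (c i < m ∧ IsEtaleOpenIn K (S i).locus (X i)))
    (hA : A.Infinite) :
    ∃ a₀ ∈ A, ∃ a ∈ A, a ≠ a₀ ∧ t + a - a₀ ∈ T := by
  obtain ⟨j, hcj, hYopen, hYinf⟩ := exists_open_piece_of_infinite S X hX (hAX ▸ hA)
  obtain ⟨a₀, ha₀⟩ := hYinf.nonempty
  have hYA : X j ⊆ A := hAX ▸ Set.subset_iUnion X j
  -- translate the neighbourhood `O` of `t` to `a₀`
  obtain ⟨O', hO'⟩ := O.exists_image_eq_translate (t - a₀)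
  have ha₀O' : a₀ ∈ O'.image := by
    rw [hO', Set.mem_setOf_eq, add_sub_cancel]
    exact htO
  obtain ⟨a, haY, hane, haO'⟩ :=
    exists_ne_mem_of_not_isEtaleIsolatedIn (S j) hYopen ha₀ (hiso (c j) hcj (S j) a₀) O' ha₀O'
  refine ⟨a₀, hYA ha₀, a, hYA haY, hane, hOT ?_⟩
  rw [hO'] at haO'
  have hre : t + a - a₀ = a + (t - a₀) := by abel
  rw [hre]
  exact haO'

/-- **No lonely translate off a hypersurface.**  With `hiso` as above and `T = ⋃_i X_i ⊆ K^m`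
decomposed (`0 < m`), there is a NON-ZERO polynomial `D` such that for every `t ∈ T` with
`D(t) ≠ 0` and every INFINITE decomposed `A ⊆ K^m`, `t + a − a₀ ∈ T` for some `a ≠ a₀` in `A`.
[folklore] -/
theorem exists_ne_zero_forall_translate_mem (hm : 0 < m)
    (hiso : ∀ c : ℕ, c < m → ∀ (S : SmoothDatum K m c) (p : Fin m → K),
      ¬ IsEtaleIsolatedIn K S.locus p)
    {T : Set (Fin m → K)} {kT : ℕ} {cT : Fin kT → ℕ} (ST : ∀ i, SmoothDatum K m (cT i))
    (XT : Fin kT → Set (Fin m → K)) (hTX : T = ⋃ i, XT i)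
    (hXT : ∀ i, (XT i).Subsingleton ∨ (cT i < m ∧ IsEtaleOpenIn K (ST i).locus (XT i))) :
    ∃ D : MvPolynomial (Fin m) K, D ≠ 0 ∧ ∀ t ∈ T, eval t D ≠ 0 →
      ∀ A : Set (Fin m → K),
        (∃ (k : ℕ) (c : Fin k → ℕ) (S : ∀ i, SmoothDatum K m (c i)) (X : Fin k → Set (Fin m → K)),
          A = ⋃ i, X i ∧ ∀ i, (X i).Subsingleton ∨ (c i < m ∧ IsEtaleOpenIn K (S i).locus (X i))) →
        A.Infinite → ∃ a₀ ∈ A, ∃ a ∈ A, a ≠ a₀ ∧ t + a - a₀ ∈ T := by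
  obtain ⟨D, hD0, hD⟩ := exists_ne_zero_forall_etaleNhd_of_iUnion hm ST XT hXT
  refine ⟨D, hD0, fun t ht htD A ⟨k, c, S, X, hAX, hX⟩ hA => ?_⟩
  obtain ⟨r, O, htO, hOT⟩ := hD t (hTX ▸ ht) htD
  exact exists_translate_mem_of_etaleNhd hiso O htO (hTX ▸ hOT) S X hAX hX hA

end Literature.ModelTheory.PseudofiniteFields
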